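import Literature.AnabelianGeometry.EtaleTheta.SettingModelSec2Hyps
import HarnessLib

/-!
# The clause "`K = K̈`" of `ThetaSetting.Sec2Hyps` is independent of the [EtTh] §1 root interface:
# the root model with `q_X := p` (kernel countermodel; universal-closure refutation; no new Prop facts)

Mochizuki, *The étale theta function …*, Publ. RIMS **45** (2009) [EtTh]: Def. 2.5 p. 39 ("`K = K̈`",
cf. Def. 1.7 (I) p. 27) and §1 p. 13 ("an open immersion `G_{K_N} ↪ (Π^tp_Y)^ell/N·(Δ^tp_Y)^ell` the image
of which … determines a Galois covering `Y_N → Y`", whence `Π^tp_{Y_N} ⊇ Ker(Π^tp_Y ↠ (Π^tp_Y)^ell)`)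
[cite: MochizukiEtTh2009, Def 2.5 p.39].

abc-iut cell, layer L2 / K-L6 slice (bundle `ThetaSetting.Sec2Hyps`, FACT-LIST F-2511), seat abc-iut-w6-d092
(gen 5). QUESTION (abc-iut-L6-lead 13:21:50Z, abc-iut-w5-d233 16:22:17Z): is either clause of abc-iut-L2-t8's
record `ThetaSetting.Sec2Hyps` (`ThetaCyclotomes.lean`) —
(a) `Kdd_eq : D.Kdd = D.K` and (b) `ker_toEll_le_GtpYN : ∀ N, Ker(Π^tp_X ↠ (Π^tp_X)^ell) ⊓ Π^tp_Y ≤ Π^tp_{Y_N}`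
— DERIVABLE from the root interface `ThetaSetting p` (`Setting.lean`), its guard `IsEtThOrigin`, and the other
clause? THIS FILE answers NO for (a) (the sibling `SettingModelYTwist.lean` answers NO for (b)):

* `ThetaSetting.modelQ p` — abc-iut-L2-t1's root model `ThetaSetting.model p` (`SettingModel.lean`) with
  `q_X := p` instead of `p²` and `q̈ := p^{1/2} ∈ ℚ̄_p` (`K_N := ℚ_p(μ_N, p^{1/N})`, `J_N` accordingly;
  abc-iut-L2-t1's Galois lemmas of part C are generic in `q ∈ ℚ_p`, the Heisenberg lattice and the theta
  quotients are untouched): every root axiom holds, and so do the guard (`modelQ_isEtThOrigin`), `Compat`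
  and clause (b) (`ker_toEll_inf_GtpY_le_GtpYN_modelQ`), but `K̈ = K_2 = ℚ_p(±1, ±√p) ≠ ℚ_p = K`
  (`modelQ_Kdd_ne`; `√p ∉ ℚ_p` since the valuation of `p` is odd, `sqrtP_not_mem_bot`);
* hence **`ThetaSetting.not_forall_Kdd_eq`**: `¬ ∀ D, D.IsEtThOrigin → (b) → D.Kdd = D.K` — clause (a) is
  print's standing NORMALISATION (Def. 2.5: it holds iff `q_X` is a square in `K`), not a lemma of the root;
  and `ThetaSetting.not_sec2Hyps_modelQ`.

Instances of the bundle: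
`ThetaSetting.model_sec2Hyps` (abc-iut-L2-d1), the Tate carriers of abc-iut-w5-d233. HONEST LIMITS:
consistency / independence evidence about OUR typed interface only (the model is degenerate along the
tempered topology: everything discrete); nothing of [EtTh] is asserted or denied; no side is taken on
[IUTchIII] Cor. 3.12. No instances on existing types; no Prop facts; `modelQ` is an explicit inhabitant of the
existing structure `ThetaSetting p`.
-/

noncomputable section

namespace Literature.AnabelianGeometry.EtaleTheta.SettingModel

open Literature.AnabelianGeometry.SemiGraphs IntermediateField
open scoped commutatorElement

variable (p : ℕ) [Fact p.Prime]

/-! ### Product bookkeeping in `Π^tp_X = Δ × Γ` (as in `SettingModel.lean`, where these are private) -/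

/-- The augmentation carries `A × B` onto `B`. [folklore] -/
private theorem map_aug_prod' (A : Subgroup Del) (B : Subgroup (GQp p)) :
    (A.prod (B.comap (Gam.toGQp p).toMonoidHom)).map (curve p).aug.toMonoidHom = B := by
  ext σ
  constructor
  · rintro ⟨x, ⟨-, hx⟩, rfl⟩
    exact hx
  · intro hσ
    exact ⟨((1 : Del), (σ : Gam p)), ⟨A.one_mem, hσ⟩, rfl⟩

/-- `Δ^tp_X ∩ (A × B) = A × 1`. [folklore] -/
private theorem prod_inf_deltaTemp' (A : Subgroup Del) (B : Subgroup (Gam p)) :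
    A.prod B ⊓ (curve p).aug.toMonoidHom.ker = A.prod ⊥ := by
  ext g
  rw [Subgroup.mem_inf, Subgroup.mem_prod, Subgroup.mem_prod, Subgroup.mem_bot]
  constructor
  · rintro ⟨⟨h1, -⟩, h3⟩
    exact ⟨h1, (mem_deltaTemp_iff p g).mp h3⟩
  · rintro ⟨h1, h2⟩
    exact ⟨⟨h1, by rw [h2]; exact B.one_mem⟩, (mem_deltaTemp_iff p g).mpr h2⟩

/-- `[A × 1 : A' × 1] = [A : A']`, computed in `F₂`. [folklore] -/
private theorem relIndex_prod_bot' (A' A : Subgroup F₂) :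
    ((A'.comap Del.val).prod (⊥ : Subgroup (Gam p))).relIndex ((A.comap Del.val).prod ⊥) =
      A'.relIndex A := by
  have h1 : ∀ B : Subgroup Del, B.prod (⊥ : Subgroup (Gam p)) = B.map (MonoidHom.inl Del (Gam p)) := by
    intro B
    ext x
    constructor
    · rintro ⟨hx1, hx2⟩
      exact ⟨x.1, hx1, Prod.ext rfl ((Subgroup.mem_bot.mp hx2).symm)⟩
    · rintro ⟨b, hb, rfl⟩
      exact ⟨hb, Subgroup.mem_bot.mpr rfl⟩
  have hinj : Function.Injective (MonoidHom.inl Del (Gam p)) := fun a b h => congrArg Prod.fst h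
  have h2 := Subgroup.relIndex_comap ((A'.comap Del.val).map (MonoidHom.inl Del (Gam p)))
    (MonoidHom.inl Del (Gam p)) (A.comap Del.val)
  rw [Subgroup.comap_map_eq_self_of_injective hinj] at h2
  rw [h1, h1, ← h2, Subgroup.relIndex_comap, Subgroup.map_comap_eq_self_of_surjective
    Del.val_bijective.2]

/-- `KTheta ≤ Δ_{Z_N} × 1 ≤ A × B` whenever `Δ_{Z_N} ≤ A`: the class-2 shadow (`SettingModelCurve`), the
model's form of "`Z_N` is cut out inside the theta quotient" (p. 14). [cite: MochizukiEtTh2009, §1 p.14] -/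
private theorem ker_toThetaM_le_prod (N : ℕ+) {A : Subgroup F₂} (hA : deltaZN N ≤ A) (B : Subgroup (Gam p)) :
    (toThetaM p).ker ≤ (A.comap Del.val).prod B := by
  intro g hg
  rw [toThetaM, QuotientGroup.ker_mk'] at hg
  obtain ⟨h1, h2⟩ := heisHom_eq_one_and_snd_eq_one_of_mem_KTheta p hg
  refine ⟨hA (ker_heisHom_le_deltaZN N h1), ?_⟩
  show g.2 ∈ B
  rw [h2]
  exact B.one_mem

/-! ## I. `q_X := p`: the clause "`K = K̈`" fails while everything else holds -/

/-- `p ∈ ℚ_p ⊆ ℚ̄_p`. [folklore] -/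
private theorem natCast_mem_bot' : ((p : ℕ) : PadicAlgCl p) ∈ (⊥ : IntermediateField ℚ_[p] (PadicAlgCl p)) :=
  IntermediateField.natCast_mem _ p

/-- `p ≠ 0` in `ℚ̄_p`. [folklore] -/
private theorem natCast_ne_zero' : ((p : ℕ) : PadicAlgCl p) ≠ 0 :=
  Nat.cast_ne_zero.mpr (Fact.out : p.Prime).ne_zero

/-- A square root `p^{1/2}` of `p` in `ℚ̄_p` (the field `K̈ = K(ζ₂, q_X^{1/2})` of Def. 1.7 p. 27 at `q_X = p`).
[cite: MochizukiEtTh2009, Def 1.7 p.27] -/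
def sqrtP : PadicAlgCl p :=
  Classical.choose (IsAlgClosed.exists_pow_nat_eq ((p : ℕ) : PadicAlgCl p) two_pos)

/-- `(p^{1/2})² = p`. [cite: MochizukiEtTh2009, Def 1.7 p.27] -/
theorem sqrtP_sq : sqrtP p ^ 2 = ((p : ℕ) : PadicAlgCl p) :=
  Classical.choose_spec (IsAlgClosed.exists_pow_nat_eq ((p : ℕ) : PadicAlgCl p) two_pos)

/-- **`√p ∉ ℚ_p`**: the `p`-adic valuation of `p` is `1`, not even — so `K̈ = K(ζ₂, q_X^{1/2}) ≠ K` at `q_X = p`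
(Def. 1.7 p. 27, Def. 2.5 p. 39). [cite: MochizukiEtTh2009, Def 2.5 p.39] -/
theorem sqrtP_not_mem_bot : sqrtP p ∉ (⊥ : IntermediateField ℚ_[p] (PadicAlgCl p)) := by
  intro h
  obtain ⟨x, hx⟩ := IntermediateField.mem_bot.mp h
  have hx2 : algebraMap ℚ_[p] (PadicAlgCl p) (x ^ 2) = algebraMap ℚ_[p] (PadicAlgCl p) p := by
    rw [map_pow, hx, sqrtP_sq, map_natCast]
  have hx2' : x ^ 2 = p := (algebraMap ℚ_[p] (PadicAlgCl p)).injective hx2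
  have hv := Padic.valuation_pow x 2
  rw [hx2', Padic.valuation_p] at hv
  omega

/-- `G_{K_N} ≤ Γ` for `K_N = ℚ_p(μ_N, p^{1/N})` (`q_X := p`). [cite: MochizukiEtTh2009, §1 p.13] -/
def gKNq (N : ℕ+) : Subgroup (Gam p) :=
  ((fieldKN ⊥ ((p : ℕ) : PadicAlgCl p) N).fixingSubgroup).comap (Gam.toGQp p).toMonoidHom

/-- `G_{J_N} ≤ Γ` for `q_X := p`. [cite: MochizukiEtTh2009, §1 p.14] -/
def gJNq (N : ℕ+) : Subgroup (Gam p) :=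
  ((fieldJN ⊥ ((p : ℕ) : PadicAlgCl p) N).fixingSubgroup).comap (Gam.toGQp p).toMonoidHom

/-- `Π^tp_{Y_N} := Δ_{Y_N} × G_{K_N}` for `q_X := p`. [cite: MochizukiEtTh2009, §1 p.13] -/
def YNq (N : ℕ+) : Subgroup (PiTp p) := ((deltaYN N).comap Del.val).prod (gKNq p N)

/-- `Π^tp_{Z_N} := Δ_{Z_N} × G_{J_N}` for `q_X := p`. [cite: MochizukiEtTh2009, §1 p.14] -/
def ZNq (N : ℕ+) : Subgroup (PiTp p) := ((deltaZN N).comap Del.val).prod (gJNq p N)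

/-- `Π^tp_{Y_1} = Π^tp_Y`. [cite: MochizukiEtTh2009, §1 p.14] -/
theorem YNq_one : YNq p 1 = (toZM p).ker := by
  rw [ker_toZM, YNq, PNat.one_coe, deltaYN_one, gKNq, fieldKN_bot_one _ (natCast_mem_bot' p),
    IntermediateField.fixingSubgroup_bot, Subgroup.comap_top]

/-- `Π^tp_{Y_N} ≤ Π^tp_Y`. [cite: MochizukiEtTh2009, §1 p.13] -/
theorem YNq_le (N : ℕ+) : YNq p N ≤ (toZM p).ker := by
  rw [ker_toZM]
  exact Subgroup.prod_mono (Subgroup.comap_mono (deltaYN_le_deltaY N)) le_top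

/-- The image of `Π^tp_{Y_N}` in `G_{ℚ_p}` is `G_{K_N}`. [cite: MochizukiEtTh2009, §1 p.13] -/
theorem map_aug_YNq (N : ℕ+) :
    (YNq p N).map (curve p).aug.toMonoidHom = (fieldKN ⊥ ((p : ℕ) : PadicAlgCl p) N).fixingSubgroup :=
  map_aug_prod' p _ _

/-- `Π^tp_{Y_N}` is normal. [cite: MochizukiEtTh2009, §1 p.14] -/
theorem YNq_normal (N : ℕ+) : (YNq p N).Normal := by
  haveI := deltaYN_normal N
  haveI := fixingSubgroup_fieldKN_bot_normal _ (natCast_mem_bot' p) N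
  haveI : ((deltaYN N).comap Del.val).Normal := Subgroup.Normal.comap inferInstance _
  haveI : (gKNq p N).Normal := Subgroup.Normal.comap inferInstance _
  exact Subgroup.prod_normal _ _

/-- `Π^tp_{Y_N} ≤ Π^tp_{Y_M}` for `M ∣ N`. [cite: MochizukiEtTh2009, §1 p.18] -/
theorem YNq_anti (M N : ℕ+) (h : (M : ℕ) ∣ N) : YNq p N ≤ YNq p M :=
  Subgroup.prod_mono (Subgroup.comap_mono (deltaYN_anti h))
    (Subgroup.comap_mono (IntermediateField.fixingSubgroup_antitone
      (fieldKN_bot_mono _ (natCast_ne_zero' p) h)))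

/-- `[Δ^tp_Y : Δ^tp_{Y_N}] = N`. [cite: MochizukiEtTh2009, §1 p.16] -/
theorem relIndex_YNq (N : ℕ+) :
    (YNq p N ⊓ (curve p).aug.toMonoidHom.ker).relIndex ((toZM p).ker ⊓ (curve p).aug.toMonoidHom.ker) =
      N := by
  rw [ker_toZM, YNq, prod_inf_deltaTemp', prod_inf_deltaTemp', ← deltaYN_one, relIndex_prod_bot',
    relIndex_deltaYN]

/-- `Π^tp_{Z_N} ≤ Π^tp_{Y_N}`. [cite: MochizukiEtTh2009, §1 p.14] -/
theorem ZNq_le (N : ℕ+) : ZNq p N ≤ YNq p N :=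
  Subgroup.prod_mono (Subgroup.comap_mono (deltaZN_le_deltaYN N))
    (Subgroup.comap_mono (IntermediateField.fixingSubgroup_antitone (fieldKN_le_fieldJN _ ⊥ N)))

/-- The image of `Π^tp_{Z_N}` in `G_{ℚ_p}` is `G_{J_N}`. [cite: MochizukiEtTh2009, §1 p.14] -/
theorem map_aug_ZNq (N : ℕ+) :
    (ZNq p N).map (curve p).aug.toMonoidHom = (fieldJN ⊥ ((p : ℕ) : PadicAlgCl p) N).fixingSubgroup :=
  map_aug_prod' p _ _

/-- `Π^tp_{Z_N}` is normal. [cite: MochizukiEtTh2009, §1 p.15] -/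
theorem ZNq_normal (N : ℕ+) : (ZNq p N).Normal := by
  haveI := deltaZN_normal N
  haveI := fixingSubgroup_fieldJN_bot_normal _ (natCast_mem_bot' p) N
  haveI : ((deltaZN N).comap Del.val).Normal := Subgroup.Normal.comap inferInstance _
  haveI : (gJNq p N).Normal := Subgroup.Normal.comap inferInstance _
  exact Subgroup.prod_normal _ _

/-- `Π^tp_{Z_N} ≤ Π^tp_{Z_M}` for `M ∣ N`. [cite: MochizukiEtTh2009, §1 p.18] -/
theorem ZNq_anti (M N : ℕ+) (h : (M : ℕ) ∣ N) : ZNq p N ≤ ZNq p M :=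
  Subgroup.prod_mono (Subgroup.comap_mono (deltaZN_anti h))
    (Subgroup.comap_mono (IntermediateField.fixingSubgroup_antitone
      (fieldJN_bot_mono _ (natCast_ne_zero' p) h)))

/-- `[Δ^tp_{Y_N} : Δ^tp_{Z_N}] = N`. [cite: MochizukiEtTh2009, §1 p.14] -/
theorem relIndex_ZNq (N : ℕ+) :
    (ZNq p N ⊓ (curve p).aug.toMonoidHom.ker).relIndex (YNq p N ⊓ (curve p).aug.toMonoidHom.ker) = N := by
  rw [ZNq, YNq, prod_inf_deltaTemp', prod_inf_deltaTemp', relIndex_prod_bot', relIndex_deltaZN]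

/-- `Ker(Π^tp_X ↠ (Π^tp_X)^Θ) ∩ Π^tp_{Y_N} ≤ Π^tp_{Z_N}`. [cite: MochizukiEtTh2009, §1 p.14] -/
theorem ker_toThetaM_inf_YNq_le_ZNq (N : ℕ+) : (toThetaM p).ker ⊓ YNq p N ≤ ZNq p N :=
  fun _ hg => ker_toThetaM_le_prod p N le_rfl _ hg.1

/-- **The root model with `q_X := p`.** Identical to abc-iut-L2-t1's `ThetaSetting.model p` (`K := ℚ_p`,
`Π^tp_X := F₂ × G_{ℚ_p}` discrete, theta quotients by the pulled-back closures, `Y`/`Z` from the Heisenberg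
lattice) except that the `q`-parameter is `p` (not a square in `ℚ_p`), `q̈ := p^{1/2} ∈ ℚ̄_p`, and accordingly
`K_N := ℚ_p(μ_N, p^{1/N})`, `J_N`. Consistency evidence only. [cite: MochizukiEtTh2009, §1 p.13] -/
abbrev _root_.Literature.AnabelianGeometry.EtaleTheta.ThetaSetting.modelQ : ThetaSetting p where
  toTemperedCurve := curve p
  qX := ((p : ℕ) : PadicAlgCl p)
  qX_mem := natCast_mem_bot' p
  norm_qX_lt_one := by
    rw [show ((p : ℕ) : PadicAlgCl p) = ((p : ℚ_[p]) : PadicAlgCl p) by simp, PadicAlgCl.norm_extends]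
    exact Padic.norm_p_lt_one
  qX_ne_zero := natCast_ne_zero' p
  sqrtqX := sqrtP p
  sqrtqX_sq := sqrtP_sq p
  toZ := toZM p
  toZ_surjective := toZM_surjective p
  isOpen_ker_toZ := isOpen_discrete _
  toZ_delta_surjective := toZM_delta_surjective p
  GtpTheta := GTheta p
  toTheta := toThetaM p
  continuous_toTheta := continuous_of_discreteTopology
  toTheta_surjective := QuotientGroup.mk'_surjective _
  ker_toTheta := QuotientGroup.ker_mk' _
  GtpEll := GEll p
  thetaToEll := thetaToEllM p
  continuous_thetaToEll := by
    haveI : DiscreteTopology (GTheta p) := QuotientGroup.discreteTopology (isOpen_discrete _)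
    exact continuous_of_discreteTopology
  thetaToEll_surjective := by
    intro y
    obtain ⟨b, rfl⟩ := QuotientGroup.mk_surjective y
    exact ⟨(b : GTheta p), rfl⟩
  ker_toEll := ker_toEllM p
  ker_thetaToEll_comm := ker_thetaToEllM_comm p
  ker_thetaToEll_central := ker_thetaToEllM_central p
  GtpYN := YNq p
  GtpYN_one := YNq_one p
  GtpYN_le := YNq_le p
  map_aug_GtpYN := map_aug_YNq p
  GtpYN_normal := YNq_normal p
  isOpen_GtpYN _ := isOpen_discrete _
  GtpYN_anti := YNq_anti p
  relIndex_deltaYN := relIndex_YNq p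
  GtpZN := ZNq p
  GtpZN_le := ZNq_le p
  map_aug_GtpZN := map_aug_ZNq p
  GtpZN_normal := ZNq_normal p
  isOpen_GtpZN _ := isOpen_discrete _
  GtpZN_anti := ZNq_anti p
  relIndex_deltaZN := relIndex_ZNq p
  ker_toTheta_le_GtpZN := ker_toThetaM_inf_YNq_le_ZNq p

/-- `modelQ` satisfies the vacuity guard `IsEtThOrigin` (`Δ_X = F̂₂ × 1` is profinite free on two
generators; abc-iut-L2-t1). [cite: MochizukiEtTh2009, §1 p.12] -/
theorem _root_.Literature.AnabelianGeometry.EtaleTheta.ThetaSetting.modelQ_isEtThOrigin :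
    (ThetaSetting.modelQ p).IsEtThOrigin :=
  ThetaSetting.IsEtThOrigin.of_free (isFreeProfiniteOnTwo_deltaHat p)

/-- `modelQ` satisfies `Compat` (as every `ThetaSetting` does: abc-iut `ThetaSetting.compat`).
[cite: MochizukiEtTh2009, §1 p.22] -/
theorem _root_.Literature.AnabelianGeometry.EtaleTheta.ThetaSetting.modelQ_compat :
    (ThetaSetting.modelQ p).Compat :=
  (ThetaSetting.modelQ p).compat

/-- **Clause (b) of `Sec2Hyps` HOLDS at `modelQ`**: `Ker(Π^tp_X ↠ (Π^tp_X)^ell) ∩ Π^tp_Y ≤ Π^tp_{Y_N}` for every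
`N` (an element of the kernel has vanishing exponent sums and trivial Galois component, abc-iut-L2-t1's
class-1 shadow). [cite: MochizukiEtTh2009, §1 p.13] -/
theorem ker_toEll_inf_GtpY_le_GtpYN_modelQ (N : ℕ+) :
    ((ThetaSetting.modelQ p).thetaToEll.comp (ThetaSetting.modelQ p).toTheta).ker ⊓
        (ThetaSetting.modelQ p).GtpY ≤ (ThetaSetting.modelQ p).GtpYN N := by
  intro g hg
  have hg1 : g ∈ KEll p := by
    rw [← ker_toEllM p]
    exact hg.1
  obtain ⟨hx, hy, h2⟩ := exponents_eq_zero_and_snd_eq_one_of_mem_KEll p hg1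
  refine ⟨?_, ?_⟩
  · change Del.val g.1 ∈ deltaYN N
    rw [deltaYN, Subgroup.mem_comap]
    exact ⟨hx, by rw [hy]; exact dvd_zero _⟩
  · change g.2 ∈ gKNq p N
    rw [h2]
    exact (gKNq p N).one_mem

/-- **`K̈ ≠ K` at `modelQ`**: `K̈ = K_2 = ℚ_p(±1, ±√p) ∋ √p ∉ ℚ_p = K` — clause (a) of `Sec2Hyps` FAILS.
[cite: MochizukiEtTh2009, Def 2.5 p.39] -/
theorem modelQ_Kdd_ne : (ThetaSetting.modelQ p).Kdd ≠ (ThetaSetting.modelQ p).K := by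
  change fieldKN ⊥ ((p : ℕ) : PadicAlgCl p) 2 ≠ ⊥
  intro h
  have hmem : sqrtP p ∈ fieldKN ⊥ ((p : ℕ) : PadicAlgCl p) 2 := by
    unfold fieldKN
    refine IntermediateField.subset_adjoin _ _ (Or.inr (Or.inr ?_))
    simp [sqrtP_sq]
  rw [h] at hmem
  exact sqrtP_not_mem_bot p hmem

/-- **`modelQ` does NOT satisfy `Sec2Hyps`** (clause (a) fails). [cite: MochizukiEtTh2009, Def 2.5 p.39] -/
theorem _root_.Literature.AnabelianGeometry.EtaleTheta.ThetaSetting.not_sec2Hyps_modelQ :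
    ¬ (ThetaSetting.modelQ p).Sec2Hyps :=
  fun h => modelQ_Kdd_ne p h.Kdd_eq

/-- **UNIVERSAL CLOSURE OF CLAUSE (a) REFUTED, sharply**: "`K = K̈`" is NOT a consequence of the root interface,
its guard and clause (b) — it is print's standing NORMALISATION (Def. 2.5), satisfied iff `q_X` is a square in
`K`. Witness: `modelQ p`. [cite: MochizukiEtTh2009, Def 2.5 p.39] -/
theorem _root_.Literature.AnabelianGeometry.EtaleTheta.ThetaSetting.not_forall_Kdd_eq :
    ¬ ∀ D : ThetaSetting p, D.IsEtThOrigin →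
      (∀ N, (D.thetaToEll.comp D.toTheta).ker ⊓ D.GtpY ≤ D.GtpYN N) → D.Kdd = D.K :=
  fun h => modelQ_Kdd_ne p
    (h (ThetaSetting.modelQ p) (ThetaSetting.modelQ_isEtThOrigin p) (ker_toEll_inf_GtpY_le_GtpYN_modelQ p))

/-- **Joint satisfiability census for clause (a)**: the guarded root with clause (b) admits BOTH a model of
"`K = K̈`" (abc-iut-L2-t1's `model p`, abc-iut-L2-d1's `model_Kdd_eq`) and a model of its negation (`modelQ p`).
[cite: MochizukiEtTh2009, Def 2.5 p.39] -/
theorem _root_.Literature.AnabelianGeometry.EtaleTheta.ThetaSetting.KddClause_independent :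
    (∃ D : ThetaSetting p, D.IsEtThOrigin ∧
        (∀ N, (D.thetaToEll.comp D.toTheta).ker ⊓ D.GtpY ≤ D.GtpYN N) ∧ D.Kdd = D.K) ∧
      ∃ D : ThetaSetting p, D.IsEtThOrigin ∧
        (∀ N, (D.thetaToEll.comp D.toTheta).ker ⊓ D.GtpY ≤ D.GtpYN N) ∧ D.Kdd ≠ D.K :=
  ⟨⟨ThetaSetting.model p, ThetaSetting.model_isEtThOrigin p, ker_toEllM_inf_GtpY_le_YN p, model_Kdd_eq p⟩,
    ⟨ThetaSetting.modelQ p, ThetaSetting.modelQ_isEtThOrigin p, ker_toEll_inf_GtpY_le_GtpYN_modelQ p,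
      modelQ_Kdd_ne p⟩⟩

end Literature.AnabelianGeometry.EtaleTheta.SettingModel

end
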